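import Mathlib.Probability.Distributions.Gaussian.IsGaussianProcess.Basic
import Mathlib.Probability.Distributions.Gaussian.IsGaussianProcess.Independence
import Mathlib.Probability.Distributions.Gaussian.Real
import Literature.Probability.LatticeModels.LatticeGraph
import HarnessLib

/-!
# Single-site innovations of lattice fields: configuration maps and one-dimensional Gaussian tilts

Topic `Literature/Probability/LatticeModels`. Brick 2 of the proof of
`Literature.Probability.LatticeModels.Lupu2016_cableSignClustersBounded` (Lupu, *Ann. Probab.* 44
(2016), Prop. 5.5). Lupu's Thm. 1 bis / Lemma 4.1 / Prop. 4.2 (§4) rest on the finite-volume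
density `e^{-H(f)}` of the free field: flipping the sign of `ψ` on a set `S` multiplies the density
by the exponential of the cross terms of `H` between `S` and `Sᶜ` (the factor
"`∏ e^{-C(e_i) ψ_{x_i} ψ_{y_i}}`" of Lemma 4.1). We shall derive this change of variables WITHOUT
densities, one site at a time, from the innovation `ζ_u = φ_u - (2d)⁻¹ ∑_{v ∼ u} φ_v`. This file
contains the deterministic and one-dimensional ingredients only:

* configuration-level maps on `ℤ^d → ℝ`: `zdNeighborSum`, `siteInnovation`, the one-site flip
  `siteFlip`, `extendOff`/`restrictOff` and the reassembly `rebuildAt u z y` of a configuration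
  from its innovation `z` at `u` and its values `y` off `u`; the inverse pair
  `rebuildAt_siteInnovation_restrictOff` / `siteInnovation_rebuildAt`, the action of the flip and
  of the shift `+ t e_u` on the innovation coordinate (`siteFlip_rebuildAt`: `z ↦ -z - 2m`;
  `rebuildAt_add_single`: `z ↦ z + t`), and measurability of all these maps;
* the one-dimensional Gaussian changes of variables `lintegral_gaussianReal_comp_add_const`
  (`∫ h(z + c) N(0,v)(dz) = ∫ h(z) e^{(2cz - c²)/2v} N(0,v)(dz)`, the density ratio
  `p_{c,v}/p_{0,v}`; the special case `c = v` is the tree's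
  `Literature.Probability.Distributions.GaussianVectorTilt.gaussianReal_map_add_coe_eq_withDensity`)
  and `lintegral_gaussianReal_comp_neg`.

The probabilistic brick — the hypothesis structure `IsInnovationSite` (`E[ζ_u X_w] = δ_{uw}/2d`),
independence of `ζ_u` from `(X_w)_{w ≠ u}`, its law `N(0, 1/2d)`, the disintegration along the
innovation and the one-site flip / Cameron–Martin identities — is the next file,
`DiscreteGFFSiteFlip.lean`, built on the maps and 1-D lemmas of this one.

References: T. Lupu, Ann. Probab. 44 (2016) 2117–2146, §4 (Lemma 4.1, Prop. 4.2) [`Lupu2016`];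
the Markov/innovation structure of the lattice free field is classical (e.g. Lawler 1991, §1.4 for
the harmonic average), tagged `[folklore]`.
-/

noncomputable section

namespace Literature.Probability.LatticeModels

open _root_.MeasureTheory _root_.ProbabilityTheory Finset
open scoped ENNReal NNReal

variable {d : ℕ}

/-! ### Configurations: neighbour sums, innovations, flips, rebuilding -/

/-- The sum of the field over the `2d` lattice neighbours of `u`. [folklore] -/
def zdNeighborSum (φ : Site d → ℝ) (u : Site d) : ℝ := ∑ v ∈ (zdGraph d).neighborFinset u, φ v

/-- The **innovation** of the configuration `φ` at `u`: `φ_u` minus the harmonic average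
`(2d)⁻¹ ∑_{v ∼ u} φ_v` of its neighbours (Lawler 1991, §1.4). [folklore] -/
def siteInnovation (φ : Site d → ℝ) (u : Site d) : ℝ := φ u - (2 * d : ℝ)⁻¹ * zdNeighborSum φ u

/-- The sign flip of a configuration at the single site `u`. [folklore] -/
def siteFlip (u : Site d) (φ : Site d → ℝ) : Site d → ℝ := Function.update φ u (-φ u)

/-- Extension by `0` at `u` of a configuration defined off `u`. [folklore] -/
def extendOff (u : Site d) (y : {w : Site d // w ≠ u} → ℝ) : Site d → ℝ :=
  fun w => if h : w = u then 0 else y ⟨w, h⟩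

/-- Reassembling a configuration from its innovation `z` at `u` and its values `y` off `u`:
`rebuildAt u z y = y` off `u` and `= z + (2d)⁻¹ ∑_{v ∼ u} y_v` at `u`. [folklore] -/
def rebuildAt (u : Site d) (z : ℝ) (y : {w : Site d // w ≠ u} → ℝ) : Site d → ℝ :=
  Function.update (extendOff u y) u (z + (2 * d : ℝ)⁻¹ * zdNeighborSum (extendOff u y) u)

/-- Restriction of a configuration to the sites `≠ u`. [folklore] -/
def restrictOff (u : Site d) (φ : Site d → ℝ) : {w : Site d // w ≠ u} → ℝ := fun w => φ w

/-- `u` is not its own neighbour, so the neighbour sum at `u` ignores the value at `u`. [folklore] -/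
theorem zdNeighborSum_update (φ : Site d → ℝ) (u : Site d) (a : ℝ) :
    zdNeighborSum (Function.update φ u a) u = zdNeighborSum φ u := by
  refine Finset.sum_congr rfl fun v hv => ?_
  rw [SimpleGraph.mem_neighborFinset] at hv
  rw [Function.update_of_ne]
  exact fun h => (h ▸ hv).ne rfl |>.elim

/-- `extendOff u (restrictOff u φ) = update φ u 0`. [folklore] -/
theorem extendOff_restrictOff (u : Site d) (φ : Site d → ℝ) :
    extendOff u (restrictOff u φ) = Function.update φ u 0 := by
  funext w
  by_cases h : w = u
  · subst h; simp [extendOff]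
  · simp [extendOff, restrictOff, h]

/-- **Reassembly**: `rebuildAt u (ζ_u φ) (φ|_{≠ u}) = φ`. [folklore] -/
theorem rebuildAt_siteInnovation_restrictOff (u : Site d) (φ : Site d → ℝ) :
    rebuildAt u (siteInnovation φ u) (restrictOff u φ) = φ := by
  rw [rebuildAt, extendOff_restrictOff, zdNeighborSum_update]
  funext w
  by_cases h : w = u
  · subst h
    simp only [Function.update_self, siteInnovation]
    ring
  · simp only [Function.update_of_ne h]

/-- The value of `rebuildAt u z y` at `u`. [folklore] -/
theorem rebuildAt_apply_self (u : Site d) (z : ℝ) (y : {w : Site d // w ≠ u} → ℝ) :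
    rebuildAt u z y u = z + (2 * d : ℝ)⁻¹ * zdNeighborSum (extendOff u y) u := by
  simp [rebuildAt]

/-- The values of `rebuildAt u z y` off `u`. [folklore] -/
theorem rebuildAt_apply_of_ne (u : Site d) (z : ℝ) (y : {w : Site d // w ≠ u} → ℝ) {w : Site d}
    (h : w ≠ u) : rebuildAt u z y w = y ⟨w, h⟩ := by
  simp [rebuildAt, extendOff, h]

/-- The neighbour sum of `rebuildAt u z y` at `u` is that of `y`. [folklore] -/
theorem zdNeighborSum_rebuildAt (u : Site d) (z : ℝ) (y : {w : Site d // w ≠ u} → ℝ) :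
    zdNeighborSum (rebuildAt u z y) u = zdNeighborSum (extendOff u y) u := by
  rw [rebuildAt, zdNeighborSum_update]

/-- The innovation of `rebuildAt u z y` at `u` is `z`. [folklore] -/
theorem siteInnovation_rebuildAt (u : Site d) (z : ℝ) (y : {w : Site d // w ≠ u} → ℝ) :
    siteInnovation (rebuildAt u z y) u = z := by
  rw [siteInnovation, zdNeighborSum_rebuildAt, rebuildAt_apply_self]
  ring

/-- **Flipping the site `u` acts on the innovation coordinate** by `z ↦ -z - 2m`,
`m = (2d)⁻¹ ∑_{v ∼ u} y_v`. [folklore] -/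
theorem siteFlip_rebuildAt (u : Site d) (z : ℝ) (y : {w : Site d // w ≠ u} → ℝ) :
    siteFlip u (rebuildAt u z y) =
      rebuildAt u (-z - 2 * ((2 * d : ℝ)⁻¹ * zdNeighborSum (extendOff u y) u)) y := by
  funext w
  by_cases h : w = u
  · subst h
    rw [siteFlip, Function.update_self, rebuildAt_apply_self, rebuildAt_apply_self]
    ring
  · rw [siteFlip, Function.update_of_ne h, rebuildAt_apply_of_ne u _ y h, rebuildAt_apply_of_ne u _ y h]

/-- **Shifting the site `u` by `t` acts on the innovation coordinate** by `z ↦ z + t`. [folklore] -/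
theorem rebuildAt_add_single (u : Site d) (z t : ℝ) (y : {w : Site d // w ≠ u} → ℝ) :
    rebuildAt u z y + Pi.single u t = rebuildAt u (z + t) y := by
  funext w
  by_cases h : w = u
  · subst h
    rw [Pi.add_apply, Pi.single_eq_same, rebuildAt_apply_self, rebuildAt_apply_self]
    ring
  · rw [Pi.add_apply, Pi.single_eq_of_ne h, add_zero, rebuildAt_apply_of_ne u _ y h,
      rebuildAt_apply_of_ne u _ y h]

/-- `rebuildAt u` is jointly measurable in `(z, y)`. [folklore] -/
theorem measurable_rebuildAt (u : Site d) :
    Measurable fun p : ℝ × ({w : Site d // w ≠ u} → ℝ) => rebuildAt u p.1 p.2 := by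
  refine measurable_pi_lambda _ fun w => ?_
  by_cases h : w = u
  · subst h
    simp only [rebuildAt_apply_self, zdNeighborSum, extendOff]
    refine measurable_fst.add (measurable_const.mul (Finset.measurable_sum _ fun v hv => ?_))
    have hv' : v ≠ w := by
      rw [SimpleGraph.mem_neighborFinset] at hv
      exact fun h => (h ▸ hv).ne rfl
    simp only [hv', dite_false]
    exact (measurable_pi_apply _).comp measurable_snd
  · simp only [rebuildAt_apply_of_ne u _ _ h]
    exact (measurable_pi_apply _).comp measurable_snd

/-- `siteInnovation · u` is measurable. [folklore] -/
theorem measurable_siteInnovation (u : Site d) :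
    Measurable fun φ : Site d → ℝ => siteInnovation φ u := by
  unfold siteInnovation zdNeighborSum
  exact (measurable_pi_apply u).sub
    (measurable_const.mul (Finset.measurable_sum _ fun v _ => measurable_pi_apply v))

/-- `restrictOff u` is measurable. [folklore] -/
theorem measurable_restrictOff (u : Site d) : Measurable (restrictOff (d := d) u) :=
  measurable_pi_lambda _ fun w => measurable_pi_apply (w : Site d)

/-- `siteFlip u` is measurable. [folklore] -/
theorem measurable_siteFlip (u : Site d) : Measurable (siteFlip (d := d) u) := by
  refine measurable_pi_lambda _ fun w => ?_
  by_cases h : w = u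
  · subst h
    simp only [siteFlip, Function.update_self]
    exact (measurable_pi_apply w).neg
  · simp only [siteFlip, Function.update_of_ne h]
    exact measurable_pi_apply w

/-! ### One-dimensional Gaussian change of variables -/

/-- **Translating a centred Gaussian**: for `v ≠ 0` and measurable `h ≥ 0`,
`∫ h(z + c) N(0,v)(dz) = ∫ h(z) exp((2cz - c²)/(2v)) N(0,v)(dz)` (ratio of the densities of
`N(c,v)` and `N(0,v)`). [folklore] -/
theorem lintegral_gaussianReal_comp_add_const {v : ℝ≥0} (hv : v ≠ 0) {h : ℝ → ℝ≥0∞}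
    (hh : Measurable h) (c : ℝ) :
    ∫⁻ z, h (z + c) ∂gaussianReal 0 v =
      ∫⁻ z, h z * ENNReal.ofReal (Real.exp ((2 * c * z - c ^ 2) / (2 * v))) ∂gaussianReal 0 v := by
  have hg : Measurable fun z => h z * ENNReal.ofReal (Real.exp ((2 * c * z - c ^ 2) / (2 * v))) :=
    hh.mul (Measurable.ennreal_ofReal (by fun_prop))
  rw [← lintegral_map hh (measurable_add_const c), gaussianReal_map_add_const, zero_add,
    gaussianReal_of_var_ne_zero _ hv, gaussianReal_of_var_ne_zero _ hv,
    lintegral_withDensity_eq_lintegral_mul _ (measurable_gaussianPDF _ _) hh,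
    lintegral_withDensity_eq_lintegral_mul _ (measurable_gaussianPDF _ _) hg]
  refine lintegral_congr fun z => ?_
  have hpdf : gaussianPDF c v z =
      gaussianPDF 0 v z * ENNReal.ofReal (Real.exp ((2 * c * z - c ^ 2) / (2 * v))) := by
    have hexp : Real.exp (-(z - 0) ^ 2 / (2 * v)) * Real.exp ((2 * c * z - c ^ 2) / (2 * v)) =
        Real.exp (-(z - c) ^ 2 / (2 * v)) := by
      rw [← Real.exp_add]; congr 1; ring
    rw [gaussianPDF, gaussianPDF, gaussianPDFReal, gaussianPDFReal,
      ← ENNReal.ofReal_mul (by positivity)]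
    set a : ℝ := (Real.sqrt (2 * Real.pi * v))⁻¹ with ha
    rw [mul_assoc, hexp]
  simp only [Pi.mul_apply]
  rw [hpdf]
  ring

/-- **Reflecting a centred Gaussian**: `∫ h(-z) N(0,v)(dz) = ∫ h N(0,v)`. [folklore] -/
theorem lintegral_gaussianReal_comp_neg (v : ℝ≥0) {h : ℝ → ℝ≥0∞} (hh : Measurable h) :
    ∫⁻ z, h (-z) ∂gaussianReal 0 v = ∫⁻ z, h z ∂gaussianReal 0 v := by
  rw [← lintegral_map hh measurable_neg, gaussianReal_map_neg, neg_zero]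

end Literature.Probability.LatticeModels
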